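/-
Copyright (c) 2026 the pub-hodgecm-mathlib formalisation cell (harness21).  Prover seat hodgecm-mathlib-K2E4-p10 (g9), Track B «K2-LIT»,
#184♮ = hLiu418 = `stmt-HodgeConjecture-24832`; socket #41, KIND W (n = 2): THE ARCHIMEDEAN ADAPTER — the `harch` letter of ★ `kindW_block_of_record_local` from ONE
pointwise BLOCK LETTER on the continued archimedean letters (the «Φ6b-ind» currency), by ★ `archGrowth_le_heightDecay_of_entryLetters` (LH4-p08) at the point's block
decomposition ★ `exists_blockDecomposition_archAt` (LH4-p08), through the index dictionary ★ FILE 2d ED. 2 (this seat).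
THEOREMS ONLY (no `def`, no `instance`, no notation, no named-fact hypothesis, no `sorry`).
-/
import Summits.HodgeConjecture.HodgeConjecture.Theorems.K2LiuSiegelEisensteinKindWArchBlockIndefinite   -- ★ p863039 (LH4-p08) `archGrowth_le_heightDecay_of_entryLetters` (⊇ ★ ArchBlock, ★ G7-C, G7-B)
import Summits.HodgeConjecture.HodgeConjecture.Theorems.K2LiuSiegelEisensteinKindWBlockAtPoint          -- ★ p862843 (LH4-p08) `exists_blockDecomposition_archAt`
import Summits.HodgeConjecture.HodgeConjecture.Theorems.K2LiuSiegelEisensteinKindWIndexDictionary      -- ★ p862798 ∕ p862947 (this seat) FILE 2d ED. 2 (the indefinite twins)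
import Summits.HodgeConjecture.HodgeConjecture.Theorems.K2LiuSiegelEisensteinWhittakerFactorLetters    -- ★ frame of the TOP's KIND-W block (`skewMatrices`, `gramR`, `HA`, `hermD`)
import HarnessLib

/-!
# Crux `HLiu418`, socket #41, KIND W — `K2LiuSiegelEisensteinKindWArchAdapter`: THE `harch` LETTER OF THE KW PAYER HEAD FROM ONE POINTWISE BLOCK LETTER
# (`harch_of_blockLetters`: ★ `archGrowth_le_heightDecay_of_entryLetters` ∘ ★ `exists_blockDecomposition_archAt` ∘ ★ FILE 2d ED. 2, at the data of record)

Cell `hodgecm-mathlib`, crux item hLiu418 = `stmt-HodgeConjecture-24832` (helper lane `--supports … --as helper`, count-neutral), route of record `HCCMUnconditional`;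
squad K2 ∕ K2Liu, road `K2_Liu`, socket #41 `sig_K2LiuSiegelEisensteinContinuation`, KIND W.  The KW payer head ★ `kindW_block_of_record_local`
(`K2LiuSiegelEisensteinKindWOfRecordLocal`) takes the ARCH size letter BY VALUE, in height currency and with exponents local in `s`:
  `harch : ∀ z, 0 < re z → ∃ N₁ N′ C a c a′ r, … ∀ j S s, dist s z < r → ∀ h, ‖Finf j S s h‖ ≤ C ‖h‖^a (e^{−c ‖h‖^{−a′} τ S} (1 + τ S)^{N₁}) ∏_{w∣∞} (1 + |det S|_w⁻¹)^{N′}`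
(`τ S = ‖(ι_∞ S_{ij})_{ij}‖`).  THIS FILE derives it, at the data of record `F := L⁺`, `E := L`, `c := complex conjugation`, `N := n + n`, `J := hermD` (so that
`H(𝔸) = (adelicGroupData F E c N J).Adelic` and `‖h‖ = adelicHeightGL N E (adelicVal … h)` definitionally), from ONE POINTWISE BLOCK LETTER in the currency the archimedean
organ speaks («Φ6b-ind»: the continued confluent hypergeometric function at the `y`-twisted index `Z_σ = y_σᴴ x_σ y_σ`, [Shimura1982, §3–§4], [Shimura1997, §19]):
**`hBL`** — locally uniformly in `s`, for every index `S` with `det S ≠ 0`, every point `h` and EVERY block decomposition `T_σ (h_∞)~_{w σ} T_σ⁻¹ = ((y_σ, b_σ), (0, d_σ))·κ_σ` of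
its archimedean part in the frames of record (movers `κ_σ κ′_σ = 1`, entries `≤ M`), there is a size letter `t_σ` squeezed between the entries of `Z_σ`
(`‖(Z_σ)_{ab}‖ ≤ t_σ ≤ K_t Σ_{ab} ‖(Z_σ)_{ab}‖`, e.g. the trace norm) with
  `‖Finf j S s h‖ ≤ C ‖h‖^a ∏_σ e^{−c_g t_σ} (1 + t_σ)^{N_g} (1 + ‖det Z_σ‖^{−N′_g})`,
where `x_σ = A_σ · S^{φ_σ} · B_σ` is the frame-conjugated index at the embedding `φ_σ` (★ FILE 2d's frames BY VALUE: `φ`, `A B Ainv Binv`, `M_f`, `hcover`), plus the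
convention `Finf j S s h = 0` at `det S = 0` (`hFinf0`; the KIND-W letters are never read at singular indices).  THEN `harch` (local exponents):
per `z`, ★ `archGrowth_le_heightDecay_of_entryLetters` (exponents `N₁ := ⌈N_g·#S⌉`, `N′₁ := ⌈N′_g⌉`, comparison constant `K := max 1 (#S·n⁴·M_f⁴)`), at each point the block
decomposition of ★ `exists_blockDecomposition_archAt`, the size links ★ `tau_le_sum_norm_entry_frameConj` ∕ `sum_norm_entry_frameConj_le` (`τ := τ S ∕ M_f²`), the determinant
facts ★ `norm_det_frameConj` (`det x_σ ≠ 0`) and ★ `prod_block_normDefect_le_prod_place_defect` (block defects ⟹ place defects, `N′ := N′₁·#S`).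
HONEST LABEL.  Count-neutral helper, closes no socket; the block letter `hBL` is the «Φ6b-ind» organ's to pay: `HC_CM` is proved only modulo the 7 printed citations
(2 remaining named inputs: hLiu418 = `stmt-HodgeConjecture-24832`, h413 = `stmt-HodgeConjecture-24833`) until rung 0 closes.
-/

set_option autoImplicit false
set_option linter.dupNamespace false -- the mandated namespace repeats `HodgeConjecture.HodgeConjecture`

noncomputable section

open scoped Matrix BigOperators NNReal ComplexOrder
-- `Classical` is needed to see the Mathlib normed-ring instances on `mixedSpace L` (note H5 of ★ `AdelicGLnGlue`; as the TOP's `hτ`)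
open scoped Classical
open NumberField NumberField.InfinitePlace IsDedekindDomain MeasureTheory

namespace Summit.HodgeConjecture.HodgeConjecture.Cruxes.HLiu418.K2LiuSiegelEisensteinKindWArchAdapter

open Literature.NumberTheory.Automorphic Literature.NumberTheory.GaloisRepresentations
open Literature.NumberTheory.Automorphic.UnitaryGroup (archAt archPart archLocal adelicGroupData adelicVal adelicVal_apply)
open Literature.NumberTheory.GelbartRogawski1991 Literature.NumberTheory.GelbartRogawski1991.GRConstruction
open Literature.NumberTheory.K2Lit.SiegelDoubled
open Summit.HodgeConjecture.HodgeConjecture.Cruxes.HLiu418.K2LiuSiegelUnipotentFourierDefs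
open Summit.HodgeConjecture.HodgeConjecture.Cruxes.HLiu418.K2LiuArchBlockHeightBound (norm_det_le_of_entry_le)
open Summit.HodgeConjecture.HodgeConjecture.Cruxes.HLiu418.K2LiuSiegelEisensteinKindWBlockAtPoint (exists_blockDecomposition_archAt)
open Summit.HodgeConjecture.HodgeConjecture.Cruxes.HLiu418.K2LiuSiegelEisensteinKindWArchBlockIndefinite (archGrowth_le_heightDecay_of_entryLetters)
open Summit.HodgeConjecture.HodgeConjecture.Cruxes.HLiu418.K2LiuSiegelEisensteinKindWIndexDictionary
  (norm_det_frameConj tau_le_sum_norm_entry_frameConj sum_norm_entry_frameConj_le prod_block_normDefect_le_prod_place_defect)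

/-- **THE ARCHIMEDEAN ADAPTER.**  Socket prefix `(L, e : Fin 2 × Fin 1 ≃ Fin n, dV hdV dW hdW)`; the index frames of ★ FILE 2d BY VALUE (`φ`, `A B Ainv Binv`, `M_f`, `hcover`);
the archimedean frames of ★ G7-C BY VALUE (complex places `w σ` fixed by `c`, `er`, `T Tinv`, `M`) with `hc : c ≠ 1`; continued archimedean letters `Finf j` vanishing at
singular indices (`hFinf0`); and the pointwise BLOCK LETTER `hBL` (module header).  THEN the `harch` binder of ★ `kindW_block_of_record_local` VERBATIM.
[cite: Shimura1982, §3] [cite: Shimura1997, §18.4 Prop. 18.14, §19] [cite: MoeglinWaldspurger1995, II.1.7, IV.1.9] [cite: BorelJacquet1979, §1.2] -/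
theorem harch_of_blockLetters
    (L : Type) [Field L] [NumberField L] [IsCMField L] {n : ℕ} (e : Fin 2 × Fin 1 ≃ Fin n)
    (dV : Fin 2 → L) (hdV : ∀ i, IsCMField.complexConj L (dV i) = dV i)
    (dW : Fin 1 → L) (hdW : ∀ i, IsCMField.complexConj L (dW i) = dW i)
    (hc : (IsCMField.complexConj L : L ≃ₐ[Fp L] L) ≠ 1)
    {Sinf : Type*} [Fintype Sinf]
    -- the index frames (★ FILE 2d) BY VALUE
    (φ : Sinf → (L →+* ℂ)) (A B Ainv Binv : Sinf → Matrix (Fin n) (Fin n) ℂ) {Mf : ℝ} (hMf : 1 ≤ Mf)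
    (hA : ∀ σ i j, ‖A σ i j‖ ≤ Mf) (hB : ∀ σ i j, ‖B σ i j‖ ≤ Mf) (hAe : ∀ σ i j, ‖Ainv σ i j‖ ≤ Mf) (hBe : ∀ σ i j, ‖Binv σ i j‖ ≤ Mf)
    (hAi : ∀ σ, Ainv σ * A σ = 1) (hBi : ∀ σ, B σ * Binv σ = 1) (hcover : ∀ w : InfinitePlace L, ∃ σ, InfinitePlace.mk (φ σ) = w)
    -- the archimedean frames (★ G7-C ∕ ★ `exists_blockDecomposition_archAt`) BY VALUE
    (w : Sinf → {w : InfinitePlace L // IsComplex w}) (hw : ∀ σ, (IsCMField.complexConj L : L ≃ₐ[Fp L] L) • (w σ).1 = (w σ).1)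
    (er : Fin n ⊕ Fin n ≃ Fin (n + n)) (T Tinv : Sinf → Matrix (Fin n ⊕ Fin n) (Fin n ⊕ Fin n) ℂ) (hT : ∀ σ, T σ * Tinv σ = 1)
    {M : ℝ} (hM : 1 ≤ M) (hTe : ∀ σ i j, ‖T σ i j‖ ≤ M) (hTe' : ∀ σ i j, ‖Tinv σ i j‖ ≤ M)
    -- the continued archimedean letters, zero at singular indices
    {m : ℕ} (Finf : Fin m → skewMatrices ((IsCMField.complexConj L : L ≃ₐ[Fp L] L) : L →+* L) ((gramR L e dV hdV dW hdW).map (algebraMap (Fp L) L)) → ℂ → HA L e dV hdV dW hdW → ℂ)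
    (hFinf0 : ∀ (j : Fin m) (S : skewMatrices ((IsCMField.complexConj L : L ≃ₐ[Fp L] L) : L →+* L) ((gramR L e dV hdV dW hdW).map (algebraMap (Fp L) L)))
      (s : ℂ) (h : HA L e dV hdV dW hdW), (S : Matrix (Fin n) (Fin n) L).det = 0 → Finf j S s h = 0)
    -- THE POINTWISE BLOCK LETTER («Φ6b-ind» currency), exponents local in `s`
    (hBL : ∀ z : ℂ, 0 < z.re → ∃ (cg Ng N'g Kt C a r : ℝ), 0 < cg ∧ 0 ≤ Ng ∧ 0 ≤ N'g ∧ 1 ≤ Kt ∧ 0 ≤ C ∧ 0 ≤ a ∧ 0 < r ∧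
      ∀ (j : Fin m) (S : skewMatrices ((IsCMField.complexConj L : L ≃ₐ[Fp L] L) : L →+* L) ((gramR L e dV hdV dW hdW).map (algebraMap (Fp L) L))) (s : ℂ),
      dist s z < r → (S : Matrix (Fin n) (Fin n) L).det ≠ 0 →
      ∀ (h : HA L e dV hdV dW hdW) (y b d : Sinf → Matrix (Fin n) (Fin n) ℂ) (κ κ' : Sinf → Matrix (Fin n ⊕ Fin n) (Fin n ⊕ Fin n) ℂ),
      (∀ σ, κ σ * κ' σ = 1) → (∀ σ, κ' σ * κ σ = 1) → (∀ σ i j, ‖κ σ i j‖ ≤ M) → (∀ σ i j, ‖κ' σ i j‖ ≤ M) →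
      (∀ σ, T σ * Matrix.reindex er.symm er.symm
          ((((archAt (Fp L) L (IsCMField.complexConj L : L ≃ₐ[Fp L] L) (n + n) (hermD L e dV hdV dW hdW) (w σ) (hw σ) hc
              (archPart (Fp L) L (IsCMField.complexConj L : L ≃ₐ[Fp L] L) (n + n) (hermD L e dV hdV dW hdW) h) :
              archLocal L (n + n) (hermD L e dV hdV dW hdW) (w σ)) : GL (Fin (n + n)) ℂ) : Matrix (Fin (n + n)) (Fin (n + n)) ℂ)) * Tinv σ =
        Matrix.fromBlocks (y σ) (b σ) 0 (d σ) * κ σ) →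
      ∃ t : Sinf → ℝ,
        (∀ σ a b, ‖((y σ)ᴴ * (A σ * ((S : Matrix (Fin n) (Fin n) L).map (φ σ)) * B σ) * y σ) a b‖ ≤ t σ) ∧
        (∀ σ, t σ ≤ Kt * ∑ a, ∑ b, ‖((y σ)ᴴ * (A σ * ((S : Matrix (Fin n) (Fin n) L).map (φ σ)) * B σ) * y σ) a b‖) ∧
        ‖Finf j S s h‖ ≤ C * adelicHeightGL (n + n) L (h : GL (Fin (n + n)) (AdeleRing (𝓞 L) L)) ^ a *
          ∏ σ, (Real.exp (-(cg * t σ)) * (1 + t σ) ^ Ng *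
            (1 + ‖((y σ)ᴴ * (A σ * ((S : Matrix (Fin n) (Fin n) L).map (φ σ)) * B σ) * y σ).det‖ ^ (-N'g)))) :
    ∀ z : ℂ, 0 < z.re → ∃ (N₁ N' : ℕ) (C a c a' r : ℝ), 0 ≤ C ∧ 0 ≤ a ∧ 0 < c ∧ 0 ≤ a' ∧ 0 < r ∧ ∀ (j : Fin m)
      (S : skewMatrices ((IsCMField.complexConj L : L ≃ₐ[Fp L] L) : L →+* L) ((gramR L e dV hdV dW hdW).map (algebraMap (Fp L) L))) (s : ℂ),
      dist s z < r → ∀ h : HA L e dV hdV dW hdW,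
      ‖Finf j S s h‖ ≤ C * adelicHeightGL (n + n) L (h : GL (Fin (n + n)) (AdeleRing (𝓞 L) L)) ^ a *
        (Real.exp (-(c * adelicHeightGL (n + n) L (h : GL (Fin (n + n)) (AdeleRing (𝓞 L) L)) ^ (-a') *
            ‖(fun i j => NumberField.mixedEmbedding L ((S : Matrix (Fin n) (Fin n) L) i j))‖)) *
          (1 + ‖(fun i j => NumberField.mixedEmbedding L ((S : Matrix (Fin n) (Fin n) L) i j))‖) ^ N₁) *
        ∏ w : InfinitePlace L, (1 + (w (S : Matrix (Fin n) (Fin n) L).det)⁻¹) ^ N' := by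
  have hn : 0 < n := by
    have h2 : Fintype.card (Fin 2 × Fin 1) = Fintype.card (Fin n) := Fintype.card_congr e
    simp only [Fintype.card_prod, Fintype.card_fin] at h2
    omega
  haveI : NeZero (n + n) := ⟨by omega⟩
  haveI : Nonempty (Fin n) := ⟨⟨0, hn⟩⟩
  have hM0 : 0 ≤ Mf := zero_le_one.trans hMf
  -- the size-comparison constant and the frame determinant bound of the index dictionary
  set K : ℝ := max 1 ((Fintype.card Sinf : ℝ) * (n : ℝ) ^ 2 * (n : ℝ) ^ 2 * Mf ^ 2 * Mf ^ 2) with hK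
  have hK1 : 1 ≤ K := le_max_left _ _
  set Cd : ℝ := ((n.factorial : ℝ) * Mf ^ n) * ((n.factorial : ℝ) * Mf ^ n) with hCd
  have hCd0 : 0 ≤ Cd := by positivity
  have hCdb : ∀ σ, ‖(Ainv σ).det‖ * ‖(Binv σ).det‖ ≤ Cd := fun σ => by
    have h1 := norm_det_le_of_entry_le (hAe σ)
    have h2 := norm_det_le_of_entry_le (hBe σ)
    rw [Fintype.card_fin] at h1 h2
    exact mul_le_mul h1 h2 (norm_nonneg _) (by positivity)
  intro z hz
  obtain ⟨cg, Ng, N'g, Kt, C, a, r, hcg, hNg, hN'g, hKt, hC, ha, hr, hb⟩ := hBL z hz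
  -- exponents for this `z`
  set N₁ : ℕ := ⌈Ng * Fintype.card Sinf⌉₊ with hN₁
  have hN₁' : Ng * Fintype.card Sinf ≤ N₁ := Nat.le_ceil _
  set N'₁ : ℕ := ⌈N'g⌉₊ with hN'₁
  have hN'₁' : N'g ≤ N'₁ := Nat.le_ceil _
  obtain ⟨C₁, a₁, c₁, hC₁, ha₁, hc₁, hAB⟩ := archGrowth_le_heightDecay_of_entryLetters (Fp L) L (IsCMField.complexConj L : L ≃ₐ[Fp L] L) (n + n)
    (hermD L e dV hdV dW hdW) hc w hw er T Tinv hT hM hTe hTe' hcg hNg hN'g hKt hN₁' hN'₁' hK1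
  refine ⟨N₁, N'₁ * Fintype.card Sinf, C * C₁ * (max 1 Cd) ^ (N'₁ * Fintype.card Sinf), a + a₁, c₁ / Mf ^ 2, 2, r, by positivity, by positivity, by positivity,
    by norm_num, hr, fun j S s hs h => ?_⟩
  set H : ℝ := adelicHeightGL (n + n) L (h : GL (Fin (n + n)) (AdeleRing (𝓞 L) L)) with hH
  have hHpos : 0 < H := adelicHeightGL_pos_holds _
  set τS : ℝ := ‖(fun i j => NumberField.mixedEmbedding L ((S : Matrix (Fin n) (Fin n) L) i j))‖ with hτS
  have hτ0 : 0 ≤ τS := norm_nonneg _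
  have hDf0 : 0 ≤ ∏ w : InfinitePlace L, (1 + (w (S : Matrix (Fin n) (Fin n) L).det)⁻¹) ^ (N'₁ * Fintype.card Sinf) :=
    Finset.prod_nonneg fun w _ => pow_nonneg (add_nonneg zero_le_one (inv_nonneg.2 (apply_nonneg _ _))) _
  have hRHS0 : 0 ≤ C * C₁ * (max 1 Cd) ^ (N'₁ * Fintype.card Sinf) * H ^ (a + a₁) *
      (Real.exp (-(c₁ / Mf ^ 2 * H ^ (-(2 : ℝ)) * τS)) * (1 + τS) ^ N₁) *
      ∏ w : InfinitePlace L, (1 + (w (S : Matrix (Fin n) (Fin n) L).det)⁻¹) ^ (N'₁ * Fintype.card Sinf) := by positivity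
  by_cases hdet : (S : Matrix (Fin n) (Fin n) L).det = 0
  · rw [hFinf0 j S s h hdet, norm_zero]
    exact hRHS0
  -- the block decomposition at the point (★ `exists_blockDecomposition_archAt`) and the block letter there
  obtain ⟨y, b, d, κ, κ', hκ, hκ', hκe, hκe', hdec⟩ := exists_blockDecomposition_archAt (Fp L) L (IsCMField.complexConj L : L ≃ₐ[Fp L] L) (n + n)
    (hermD L e dV hdV dW hdW) hc w hw er T Tinv hT hM h
  obtain ⟨t, ht, ht', hbnd⟩ := hb j S s hs hdet h y b d κ κ' hκ hκ' hκe hκe' hdec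
  -- the frame-conjugated indices are non-degenerate (★ `norm_det_frameConj`)
  have hx0 : ∀ σ, ((fun σ => A σ * ((S : Matrix (Fin n) (Fin n) L).map (φ σ)) * B σ) σ).det ≠ 0 := by
    intro σ h0
    have h1 := norm_det_frameConj L φ A B σ (S : Matrix (Fin n) (Fin n) L)
    have hA0 : ‖(A σ).det‖ ≠ 0 := norm_ne_zero_iff.2 (Matrix.isUnit_det_of_left_inverse (hAi σ)).ne_zero
    have hB0 : ‖(B σ).det‖ ≠ 0 := norm_ne_zero_iff.2 (Matrix.isUnit_det_of_right_inverse (hBi σ)).ne_zero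
    have hS0 : (InfinitePlace.mk (φ σ)) (S : Matrix (Fin n) (Fin n) L).det ≠ 0 := (InfinitePlace.pos_iff.2 hdet).ne'
    have h2 : ‖(A σ * ((S : Matrix (Fin n) (Fin n) L).map (φ σ)) * B σ).det‖ = 0 := by rw [h0, norm_zero]
    rw [h2] at h1
    exact mul_ne_zero (mul_ne_zero hA0 hB0) hS0 h1.symm
  -- the size links (★ FILE 2d ED. 2) at `τ := τ S ∕ M_f²`
  have hMf2 : 0 < Mf ^ 2 := by positivity
  have hlow : τS / Mf ^ 2 ≤ ∑ σ, ∑ a, ∑ b, ‖(A σ * ((S : Matrix (Fin n) (Fin n) L).map (φ σ)) * B σ) a b‖ := by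
    rw [div_le_iff₀ hMf2]
    have h1 := tau_le_sum_norm_entry_frameConj L φ A B Ainv Binv hMf hAi hBi hAe hBe hcover (S : Matrix (Fin n) (Fin n) L)
    linarith
  have hup : ∑ σ, ∑ a, ∑ b, ‖(A σ * ((S : Matrix (Fin n) (Fin n) L).map (φ σ)) * B σ) a b‖ ≤ K * (τS / Mf ^ 2) := by
    have h1 := sum_norm_entry_frameConj_le L φ A B hMf hA hB (S : Matrix (Fin n) (Fin n) L)
    have hcancel : Mf ^ 2 * (τS / Mf ^ 2) = τS := by field_simp
    have hkey : ((Fintype.card Sinf : ℝ) * (n : ℝ) ^ 2 * (n : ℝ) ^ 2 * Mf ^ 2 * Mf ^ 2) * (τS / Mf ^ 2) =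
        (Fintype.card Sinf : ℝ) * ((n : ℝ) ^ 2 * ((n : ℝ) ^ 2 * Mf ^ 2 * τS)) := by
      calc ((Fintype.card Sinf : ℝ) * (n : ℝ) ^ 2 * (n : ℝ) ^ 2 * Mf ^ 2 * Mf ^ 2) * (τS / Mf ^ 2)
          = (Fintype.card Sinf : ℝ) * (n : ℝ) ^ 2 * (n : ℝ) ^ 2 * Mf ^ 2 * (Mf ^ 2 * (τS / Mf ^ 2)) := by ring
        _ = (Fintype.card Sinf : ℝ) * ((n : ℝ) ^ 2 * ((n : ℝ) ^ 2 * Mf ^ 2 * τS)) := by rw [hcancel]; ring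
    calc ∑ σ, ∑ a, ∑ b, ‖(A σ * ((S : Matrix (Fin n) (Fin n) L).map (φ σ)) * B σ) a b‖ ≤ (Fintype.card Sinf : ℝ) * ((n : ℝ) ^ 2 * ((n : ℝ) ^ 2 * Mf ^ 2 * τS)) := h1
      _ = ((Fintype.card Sinf : ℝ) * (n : ℝ) ^ 2 * (n : ℝ) ^ 2 * Mf ^ 2 * Mf ^ 2) * (τS / Mf ^ 2) := hkey.symm
      _ ≤ K * (τS / Mf ^ 2) := mul_le_mul_of_nonneg_right (le_max_right _ _) (by positivity)
  -- ★ `archGrowth_le_heightDecay_of_entryLetters` at the point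
  have hmain := hAB h y b d κ κ' hκ hκ' hκe hκe' hdec (fun σ => A σ * ((S : Matrix (Fin n) (Fin n) L).map (φ σ)) * B σ) hx0 t ht ht' (τS / Mf ^ 2) hlow hup
  rw [adelicVal_apply] at hmain
  -- the two conversions of the right-hand side: `(1 + τ S∕M_f²)^{N₁} ≤ (1 + τ S)^{N₁}` and the defect transfer (★ FILE 2d ED. 2)
  have hexp : Real.exp (-(c₁ * H ^ (-(2 : ℝ)) * (τS / Mf ^ 2))) = Real.exp (-(c₁ / Mf ^ 2 * H ^ (-(2 : ℝ)) * τS)) := by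
    congr 1
    ring
  have hpoly : (1 + τS / Mf ^ 2) ^ N₁ ≤ (1 + τS) ^ N₁ :=
    pow_le_pow_left₀ (by positivity) (by linarith [div_le_self hτ0 (one_le_pow₀ hMf : (1 : ℝ) ≤ Mf ^ 2)]) N₁
  have hdef := prod_block_normDefect_le_prod_place_defect L φ A B Ainv Binv hAi hBi hCd0 hCdb (S : Matrix (Fin n) (Fin n) L) N'₁
  have hmid0 : 0 ≤ C₁ * H ^ a₁ * (Real.exp (-(c₁ * H ^ (-(2 : ℝ)) * (τS / Mf ^ 2))) * (1 + τS / Mf ^ 2) ^ N₁) := by positivity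
  have hblk0 : 0 ≤ ∏ σ, (1 + ‖(A σ * ((S : Matrix (Fin n) (Fin n) L).map (φ σ)) * B σ).det‖⁻¹) ^ N'₁ := Finset.prod_nonneg fun σ _ => pow_nonneg (add_nonneg zero_le_one (inv_nonneg.2 (norm_nonneg _))) _
  calc ‖Finf j S s h‖ ≤ C * H ^ a * ∏ σ, (Real.exp (-(cg * t σ)) * (1 + t σ) ^ Ng * (1 + ‖((y σ)ᴴ * (A σ * ((S : Matrix (Fin n) (Fin n) L).map (φ σ)) * B σ) * y σ).det‖ ^ (-N'g))) := hbnd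
    _ ≤ C * H ^ a * (C₁ * H ^ a₁ * (Real.exp (-(c₁ * H ^ (-(2 : ℝ)) * (τS / Mf ^ 2))) * (1 + τS / Mf ^ 2) ^ N₁) * ∏ σ, (1 + ‖(A σ * ((S : Matrix (Fin n) (Fin n) L).map (φ σ)) * B σ).det‖⁻¹) ^ N'₁) :=
        mul_le_mul_of_nonneg_left hmain (by positivity)
    _ ≤ C * H ^ a * (C₁ * H ^ a₁ * (Real.exp (-(c₁ / Mf ^ 2 * H ^ (-(2 : ℝ)) * τS)) * (1 + τS) ^ N₁) *
        ((max 1 Cd) ^ (N'₁ * Fintype.card Sinf) * ∏ w : InfinitePlace L, (1 + (w (S : Matrix (Fin n) (Fin n) L).det)⁻¹) ^ (N'₁ * Fintype.card Sinf))) := by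
        refine mul_le_mul_of_nonneg_left (mul_le_mul ?_ hdef hblk0 (by positivity)) (by positivity)
        rw [hexp]
        exact mul_le_mul_of_nonneg_left (mul_le_mul_of_nonneg_left hpoly (Real.exp_pos _).le) (by positivity)
    _ = C * C₁ * (max 1 Cd) ^ (N'₁ * Fintype.card Sinf) * (H ^ a * H ^ a₁) *
        (Real.exp (-(c₁ / Mf ^ 2 * H ^ (-(2 : ℝ)) * τS)) * (1 + τS) ^ N₁) *
        ∏ w : InfinitePlace L, (1 + (w (S : Matrix (Fin n) (Fin n) L).det)⁻¹) ^ (N'₁ * Fintype.card Sinf) := by ring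
    _ = C * C₁ * (max 1 Cd) ^ (N'₁ * Fintype.card Sinf) * H ^ (a + a₁) *
        (Real.exp (-(c₁ / Mf ^ 2 * H ^ (-(2 : ℝ)) * τS)) * (1 + τS) ^ N₁) *
        ∏ w : InfinitePlace L, (1 + (w (S : Matrix (Fin n) (Fin n) L).det)⁻¹) ^ (N'₁ * Fintype.card Sinf) := by rw [← Real.rpow_add hHpos]

end Summit.HodgeConjecture.HodgeConjecture.Cruxes.HLiu418.K2LiuSiegelEisensteinKindWArchAdapter

end
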